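import Summits.CriticalPhenomena.PercolationContinuityZ3.Theorems.PercNearOneGluingNoHeavyLowerTailCILUnionExchangeHarrisSubstitutes
import HarnessLib

/-!
# `NoHeavyLowerTail` (stmt-CriticalPhenomena-4575) — the weight segment of the avoided-vertex union
# exchange is nonempty (`t₁ + t₂ ≤ u`)

Prover `prim-gen-induct` (gen 9), `--supports stmt-CriticalPhenomena-4575`.  No definitions, no named facts,
no sorries; standard axioms.

Setting as in `…CILUnionExchangeAvoidedSplit` (BLOBQUOTIENT.md §26–28): observer `o`, terminals `a₁, a₂`,
avoided vertex `a`; `Oᵢ = {o ↔ aᵢ}`, `M = {a₁ ↔ a₂}`, `Rᵢ = {aᵢ ↮ a}`, `R = R₁ ∩ R₂`, `Eᵢ = Mᶜ ∩ Rᵢ`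
(`= {C_{aᵢ} ∌ a_{3-i}, a}`), `Π′ = Mᶜ ∩ R`.  The conjectured domination "DOM2" (law of `C_o` given
`o ↔ {a₁,a₂}, o ↮ a` dominates a mixture of the laws of `C_{aᵢ}` given `aᵢ ↮ a`) has the exact feasible weight
segment `Λᵢ ≥ tᵢ := μ(Oᵢ | Eᵢ)`, `Λ₁ μ(R₁) + Λ₂ μ(R₂) = μ(U ∩ D)`; the segment is nonempty iff
`t₁ + t₂ ≤ u := μ(o ↔ W | M, R)`, which is also the `𝒜 = M` instance of every single-world split
(`…AvoidedSplit`, hypotheses `(S₁^θ)`, `(S₂^{1-θ})`).  This file PROVES it: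

* `UnionExchange.pair_avoided_segment_nonempty` —
  `μ(E₁ ∩ O₁) μ(E₂) μ(M ∩ R) + μ(E₂ ∩ O₂) μ(E₁) μ(M ∩ R) ≤ μ((O₁ ∪ O₂) ∩ M ∩ R) μ(E₁) μ(E₂)`.

Proof ("Kozma–Nitzan's Lemma 2 with an avoided vertex, merged form"): the three-cluster lemma
`μ(Oᵢ ∩ Eᵢ) μ(Π′) ≤ μ(Oᵢ ∩ Π′) μ(Eᵢ)` (BHK Thm. 2.1 with `S = {aᵢ}`, `T = {a_{3-i}, a}`: `Oᵢ` is increasing in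
`C_{aᵢ}`, `{a_{3-i} ↮ a}` decreasing in `C_T`), disjointness of `O₁, O₂` on `Mᶜ`, and positive association of
the glued cluster `C_{a₁,a₂}` given `R` (`μ(R) μ(R ∩ O ∩ M) ≥ μ(R ∩ O) μ(R ∩ M)`, `O = O₁ ∪ O₂`).
-/

noncomputable section

open MeasureTheory Set
open Literature.Probability.LatticeModels (prodBernoulli)
open Literature.Probability.Percolation Literature.Probability.Percolation.TwoSetExchange

namespace Summit.CriticalPhenomena.PercolationContinuityZ3.Theorems

namespace UnionExchange

variable {V : Type*} [Fintype V]

omit [Fintype V] in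
/-- `{a ↮ b}` is a decreasing event. [folklore] -/
theorem isLowerSet_notReachable (a b : V) :
    IsLowerSet {ω : BondConfig V | ¬ (openGraph ω).Reachable a b} :=
  (isUpperSet_openConn a b).compl

omit [Fintype V] in
/-- The separation event `{S ↮ T}` for `S = {s}`, `T = {t, a}` is `{s ↮ t} ∩ {s ↮ a}`. [folklore] -/
theorem sep_singleton_pair (s t a : V) :
    {ω : BondConfig V | ∀ u ∈ ({s} : Set V), ∀ v ∈ ({t, a} : Set V), ¬ (openGraph ω).Reachable u v} =
      {ω : BondConfig V | ¬ (openGraph ω).Reachable s t} ∩ {ω | ¬ (openGraph ω).Reachable s a} := by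
  ext ω
  simp only [mem_setOf_eq, mem_insert_iff, mem_singleton_iff, forall_eq_or_imp, forall_eq, mem_inter_iff]

/-- **The three-cluster lemma.**  With `Eᵢ = {aᵢ ↮ aⱼ} ∩ {aᵢ ↮ a}` and `Π′ = Eᵢ ∩ {aⱼ ↮ a}`:
`μ(Eᵢ ∩ {o ↔ aᵢ}) μ(Π′) ≤ μ(Π′ ∩ {o ↔ aᵢ}) μ(Eᵢ)`, i.e. `μ(o ↔ aᵢ | Eᵢ) ≤ μ(o ↔ aᵢ | Π′)`: in the world
where `C_{aᵢ}` avoids `{aⱼ, a}`, the attachment `{o ↔ aᵢ}` (increasing in `C_{aᵢ}`) and `{aⱼ ↮ a}` (decreasing in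
the glued cluster `C_{aⱼ,a}`) are positively correlated (BHK Thm. 2.1 / 1.5 with sets). -/
theorem attach_sep_le_attach_threeSep (w : Sym2 V → unitInterval) (o aᵢ aⱼ a : V) :
    (prodBernoulli w).real (({ω : BondConfig V | ¬ (openGraph ω).Reachable aᵢ aⱼ} ∩
          {ω | ¬ (openGraph ω).Reachable aᵢ a}) ∩ openConn o aᵢ) *
      (prodBernoulli w).real (({ω : BondConfig V | ¬ (openGraph ω).Reachable aᵢ aⱼ} ∩
          {ω | ¬ (openGraph ω).Reachable aᵢ a}) ∩ {ω | ¬ (openGraph ω).Reachable aⱼ a}) ≤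
    (prodBernoulli w).real (({ω : BondConfig V | ¬ (openGraph ω).Reachable aᵢ aⱼ} ∩
          {ω | ¬ (openGraph ω).Reachable aᵢ a}) ∩ (openConn o aᵢ ∩ {ω | ¬ (openGraph ω).Reachable aⱼ a})) *
      (prodBernoulli w).real ({ω : BondConfig V | ¬ (openGraph ω).Reachable aᵢ aⱼ} ∩
          {ω | ¬ (openGraph ω).Reachable aᵢ a}) := by
  classical
  have hS : aᵢ ∈ ({aᵢ} : Set V) := by simp
  have hT : aⱼ ∈ ({aⱼ, a} : Set V) := by simp
  have tO : ∀ ⦃ω ω' : BondConfig V⦄,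
      (⋃ u ∈ ({aᵢ} : Set V), openEdgeCluster ω u) ⊆ (⋃ u ∈ ({aᵢ} : Set V), openEdgeCluster ω' u) →
      (⋃ u ∈ ({aⱼ, a} : Set V), openEdgeCluster ω' u) ⊆ (⋃ u ∈ ({aⱼ, a} : Set V), openEdgeCluster ω u) →
      ω ∈ (openConn o aᵢ : Set (BondConfig V)) → ω' ∈ (openConn o aᵢ : Set (BondConfig V)) := by
    intro ω ω' h1 h2 h
    have h' : ω ∈ (openConn aᵢ o : Set (BondConfig V)) := (show (openGraph ω).Reachable o aᵢ from h).symm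
    have := typePlus_openConn_of_mem ({aᵢ} : Set V) ({aⱼ, a} : Set V) hS o h1 h2 h'
    exact (show (openGraph ω').Reachable aᵢ o from this).symm
  have tR : ∀ ⦃ω ω' : BondConfig V⦄,
      (⋃ u ∈ ({aᵢ} : Set V), openEdgeCluster ω u) ⊆ (⋃ u ∈ ({aᵢ} : Set V), openEdgeCluster ω' u) →
      (⋃ u ∈ ({aⱼ, a} : Set V), openEdgeCluster ω' u) ⊆ (⋃ u ∈ ({aⱼ, a} : Set V), openEdgeCluster ω u) →
      ω ∈ {ω : BondConfig V | ¬ (openGraph ω).Reachable aⱼ a} →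
        ω' ∈ {ω : BondConfig V | ¬ (openGraph ω).Reachable aⱼ a} := by
    intro ω ω' h1 h2 h
    exact typePlus_not_openConn_of_mem ({aᵢ} : Set V) ({aⱼ, a} : Set V) hT a h1 h2 h
  have key := setTwoClusterExchange w ({aᵢ} : Set V) ({aⱼ, a} : Set V)
    (A₁ := (openConn o aᵢ : Set (BondConfig V))) (A₂ := {ω : BondConfig V | ¬ (openGraph ω).Reachable aⱼ a})
    (B₁ := Set.univ) (B₂ := Set.univ) tO tR (fun _ _ _ _ h => h) (fun _ _ _ _ h => h)
  rw [sep_singleton_pair] at key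
  simp only [inter_univ] at key
  linarith [key]

/-- **The weight segment of DOM2 is nonempty (`t₁ + t₂ ≤ u`).**  With `Oᵢ = {o ↔ aᵢ}`, `M = {a₁ ↔ a₂}`,
`Rᵢ = {aᵢ ↮ a}`, `R = R₁ ∩ R₂`, `Eᵢ = Mᶜ ∩ Rᵢ`:
`μ(E₁ ∩ O₁) μ(E₂) μ(M ∩ R) + μ(E₂ ∩ O₂) μ(E₁) μ(M ∩ R) ≤ μ((O₁ ∪ O₂) ∩ (M ∩ R)) μ(E₁) μ(E₂)`,
i.e. `μ(o ↔ a₁ | E₁) + μ(o ↔ a₂ | E₂) ≤ μ(o ↔ {a₁,a₂} | a₁ ↔ a₂, {a₁,a₂} ↮ a)`.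
Proof: `tᵢ ≤ tᵢ⁺ := μ(Oᵢ | Π′)` (`attach_sep_le_attach_threeSep`), `t₁⁺ + t₂⁺ = μ(O | Π′)` (`O₁, O₂` disjoint off
`M`), and `μ(O | Π′) ≤ μ(O | M ∩ R)` (positive association of `C_{a₁,a₂}` given `R`, BHK Thm. 2.1). -/
theorem pair_avoided_segment_nonempty (w : Sym2 V → unitInterval) (o a₁ a₂ a : V) :
    (prodBernoulli w).real (({ω : BondConfig V | ¬ (openGraph ω).Reachable a₁ a₂} ∩
          {ω | ¬ (openGraph ω).Reachable a₁ a}) ∩ openConn o a₁) *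
        (prodBernoulli w).real ({ω : BondConfig V | ¬ (openGraph ω).Reachable a₂ a₁} ∩
          {ω | ¬ (openGraph ω).Reachable a₂ a}) *
        (prodBernoulli w).real (openConn a₁ a₂ ∩ ({ω : BondConfig V | ¬ (openGraph ω).Reachable a₁ a} ∩
          {ω | ¬ (openGraph ω).Reachable a₂ a})) +
      (prodBernoulli w).real (({ω : BondConfig V | ¬ (openGraph ω).Reachable a₂ a₁} ∩
          {ω | ¬ (openGraph ω).Reachable a₂ a}) ∩ openConn o a₂) *
        (prodBernoulli w).real ({ω : BondConfig V | ¬ (openGraph ω).Reachable a₁ a₂} ∩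
          {ω | ¬ (openGraph ω).Reachable a₁ a}) *
        (prodBernoulli w).real (openConn a₁ a₂ ∩ ({ω : BondConfig V | ¬ (openGraph ω).Reachable a₁ a} ∩
          {ω | ¬ (openGraph ω).Reachable a₂ a})) ≤
    (prodBernoulli w).real ((openConn o a₁ ∪ openConn o a₂) ∩ (openConn a₁ a₂ ∩
        ({ω : BondConfig V | ¬ (openGraph ω).Reachable a₁ a} ∩ {ω | ¬ (openGraph ω).Reachable a₂ a}))) *
      (prodBernoulli w).real ({ω : BondConfig V | ¬ (openGraph ω).Reachable a₁ a₂} ∩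
          {ω | ¬ (openGraph ω).Reachable a₁ a}) *
      (prodBernoulli w).real ({ω : BondConfig V | ¬ (openGraph ω).Reachable a₂ a₁} ∩
          {ω | ¬ (openGraph ω).Reachable a₂ a}) := by
  classical
  set μ := prodBernoulli w with hμ
  set O₁ : Set (BondConfig V) := openConn o a₁ with hO₁
  set O₂ : Set (BondConfig V) := openConn o a₂ with hO₂
  set Mr : Set (BondConfig V) := openConn a₁ a₂ with hMr
  set Mc₁ : Set (BondConfig V) := {ω | ¬ (openGraph ω).Reachable a₁ a₂} with hMc₁
  set Mc₂ : Set (BondConfig V) := {ω | ¬ (openGraph ω).Reachable a₂ a₁} with hMc₂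
  set R₁ : Set (BondConfig V) := {ω | ¬ (openGraph ω).Reachable a₁ a} with hR₁
  set R₂ : Set (BondConfig V) := {ω | ¬ (openGraph ω).Reachable a₂ a} with hR₂
  have hMc : Mc₂ = Mc₁ := by
    ext ω; simp only [hMc₁, hMc₂, mem_setOf_eq]
    exact ⟨fun h h' => h h'.symm, fun h h' => h h'.symm⟩
  -- the two three-cluster lemmas
  have h3a := attach_sep_le_attach_threeSep w o a₁ a₂ a
  have h3b := attach_sep_le_attach_threeSep w o a₂ a₁ a
  simp only [← hμ, ← hO₁, ← hO₂, ← hMc₁, ← hMc₂, ← hR₁, ← hR₂] at h3a h3b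
  rw [hMc] at h3b ⊢
  -- Π′ written from either side
  set Pp : Set (BondConfig V) := Mc₁ ∩ R₁ ∩ R₂ with hPp
  have ePp2 : Mc₁ ∩ R₂ ∩ R₁ = Pp := by
    rw [hPp, inter_assoc, inter_assoc, inter_comm R₂ R₁]
  rw [ePp2] at h3b
  -- glued PA given `R = R₁ ∩ R₂`: μ(R ∩ O) μ(R ∩ Mr) ≤ μ(R ∩ (O ∩ Mr)) μ(R)
  have hS1 : a₁ ∈ ({a₁, a₂} : Set V) := by simp
  have hS2 : a₂ ∈ ({a₁, a₂} : Set V) := by simp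
  have tO : ∀ ⦃ω ω' : BondConfig V⦄,
      (⋃ u ∈ ({a₁, a₂} : Set V), openEdgeCluster ω u) ⊆ (⋃ u ∈ ({a₁, a₂} : Set V), openEdgeCluster ω' u) →
      (⋃ u ∈ ({a} : Set V), openEdgeCluster ω' u) ⊆ (⋃ u ∈ ({a} : Set V), openEdgeCluster ω u) →
      ω ∈ O₁ ∪ O₂ → ω' ∈ O₁ ∪ O₂ := by
    intro ω ω' h1 h2 h
    rcases h with h | h
    · have h' : ω ∈ (openConn a₁ o : Set (BondConfig V)) := (show (openGraph ω).Reachable o a₁ from h).symm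
      have := typePlus_openConn_of_mem ({a₁, a₂} : Set V) ({a} : Set V) hS1 o h1 h2 h'
      exact Or.inl (show (openGraph ω').Reachable a₁ o from this).symm
    · have h' : ω ∈ (openConn a₂ o : Set (BondConfig V)) := (show (openGraph ω).Reachable o a₂ from h).symm
      have := typePlus_openConn_of_mem ({a₁, a₂} : Set V) ({a} : Set V) hS2 o h1 h2 h'
      exact Or.inr (show (openGraph ω').Reachable a₂ o from this).symm
  have tM : ∀ ⦃ω ω' : BondConfig V⦄,
      (⋃ u ∈ ({a₁, a₂} : Set V), openEdgeCluster ω u) ⊆ (⋃ u ∈ ({a₁, a₂} : Set V), openEdgeCluster ω' u) →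
      (⋃ u ∈ ({a} : Set V), openEdgeCluster ω' u) ⊆ (⋃ u ∈ ({a} : Set V), openEdgeCluster ω u) →
      ω ∈ Mr → ω' ∈ Mr := by
    intro ω ω' h1 h2 h
    exact typePlus_openConn_of_mem ({a₁, a₂} : Set V) ({a} : Set V) hS1 a₂ h1 h2 h
  have hPA := setTwoClusterExchange w ({a₁, a₂} : Set V) ({a} : Set V)
    (A₁ := O₁ ∪ O₂) (A₂ := Mr) (B₁ := Set.univ) (B₂ := Set.univ) tO tM
    (fun _ _ _ _ h => h) (fun _ _ _ _ h => h)
  rw [sep_pair_singleton] at hPA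
  simp only [inter_univ, ← hμ, ← hR₁, ← hR₂] at hPA
  -- hPA : μ(R ∩ (O₁∪O₂)) * μ(R ∩ Mr) ≤ μ(R ∩ ((O₁∪O₂) ∩ Mr)) * μ(R),  R = R₁ ∩ R₂
  set R : Set (BondConfig V) := R₁ ∩ R₂ with hR
  -- decompositions: R = (Mr ∩ R) ⊔ Pp ;  R ∩ O = (O ∩ (Mr ∩ R)) ⊔ (Pp ∩ O₁) ⊔ (Pp ∩ O₂)
  have dR : R = (Mr ∩ R) ∪ Pp := by
    ext ω
    simp only [hR, hPp, hMr, hMc₁, openConn, mem_inter_iff, mem_union, mem_setOf_eq]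
    tauto
  have dRdisj : Disjoint (Mr ∩ R) Pp := by
    rw [Set.disjoint_left]
    rintro ω ⟨hm, _⟩ ⟨⟨hmc, _⟩, _⟩
    exact hmc hm
  have dO : R ∩ (O₁ ∪ O₂) = ((O₁ ∪ O₂) ∩ (Mr ∩ R)) ∪ ((Pp ∩ O₁) ∪ (Pp ∩ O₂)) := by
    ext ω
    simp only [hR, hPp, hMr, hMc₁, hO₁, hO₂, openConn, mem_inter_iff, mem_union, mem_setOf_eq]
    tauto
  have dO1 : Disjoint ((O₁ ∪ O₂) ∩ (Mr ∩ R)) ((Pp ∩ O₁) ∪ (Pp ∩ O₂)) := by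
    rw [Set.disjoint_left]
    rintro ω ⟨_, hm, _⟩ (⟨⟨⟨hmc, _⟩, _⟩, _⟩ | ⟨⟨⟨hmc, _⟩, _⟩, _⟩)
    · exact hmc hm
    · exact hmc hm
  have dO2 : Disjoint (Pp ∩ O₁) (Pp ∩ O₂) := by
    rw [Set.disjoint_left]
    rintro ω ⟨⟨⟨hmc, _⟩, _⟩, h1⟩ ⟨_, h2⟩
    exact hmc ((show (openGraph ω).Reachable o a₁ from h1).symm.trans (show (openGraph ω).Reachable o a₂ from h2))
  have mR : μ.real R = μ.real (Mr ∩ R) + μ.real Pp := by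
    conv_lhs => rw [dR]
    rw [measureReal_union dRdisj MeasurableSet.of_discrete]
  have mO : μ.real (R ∩ (O₁ ∪ O₂)) = μ.real ((O₁ ∪ O₂) ∩ (Mr ∩ R)) + (μ.real (Pp ∩ O₁) + μ.real (Pp ∩ O₂)) := by
    rw [dO, measureReal_union dO1 MeasurableSet.of_discrete, measureReal_union dO2 MeasurableSet.of_discrete]
  have eRM : R ∩ Mr = Mr ∩ R := inter_comm _ _
  have eROM : R ∩ ((O₁ ∪ O₂) ∩ Mr) = (O₁ ∪ O₂) ∩ (Mr ∩ R) := by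
    ext ω; simp only [mem_inter_iff, mem_union]; tauto
  rw [mO, eRM, eROM, mR] at hPA
  -- normalise the three-cluster lemmas' sets
  have e1 : Mc₁ ∩ R₁ ∩ (O₁ ∩ R₂) = Pp ∩ O₁ := by
    ext ω; simp only [hPp, mem_inter_iff]; tauto
  have e2 : Mc₁ ∩ R₂ ∩ (O₂ ∩ R₁) = Pp ∩ O₂ := by
    ext ω; simp only [hPp, mem_inter_iff]; tauto
  rw [e1] at h3a
  rw [e2] at h3b
  -- nonnegativity facts and the final combination
  have nn : ∀ E : Set (BondConfig V), 0 ≤ μ.real E := fun E => measureReal_nonneg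
  have hE1 := nn (Mc₁ ∩ R₁); have hE2 := nn (Mc₁ ∩ R₂); have hP := nn Pp
  have hMR := nn (Mr ∩ R); have hPO1 := nn (Pp ∩ O₁); have hPO2 := nn (Pp ∩ O₂)
  have hOMR := nn ((O₁ ∪ O₂) ∩ (Mr ∩ R))
  -- goal sets:  note `openConn a₁ a₂ ∩ (R₁ ∩ R₂) = Mr ∩ R`
  show μ.real (Mc₁ ∩ R₁ ∩ O₁) * μ.real (Mc₁ ∩ R₂) * μ.real (Mr ∩ R) +
      μ.real (Mc₁ ∩ R₂ ∩ O₂) * μ.real (Mc₁ ∩ R₁) * μ.real (Mr ∩ R) ≤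
    μ.real ((O₁ ∪ O₂) ∩ (Mr ∩ R)) * μ.real (Mc₁ ∩ R₁) * μ.real (Mc₁ ∩ R₂)
  by_cases hp0 : μ.real Pp = 0
  · -- then μ(Pp ∩ Oᵢ) = 0 and, by Harris for the two decreasing events `Eᵢ`... we avoid Harris: use h3a/h3b
    -- h3a: μ(E₁ ∩ O₁) μ(Pp) ≤ μ(Pp ∩ O₁) μ(E₁) gives nothing; instead bound directly: E₁ ∩ E₂ ⊆ ... we use
    -- μ(E₁ ∩ O₁) μ(E₂) μ(MrR) ≤ ?  Observe E₁ ∩ O₁ ⊆ R₁ and we need a genuinely different argument: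
    -- μ(Pp)=0 ⇒ μ(E₁) μ(E₂) = 0 by positive correlation of the decreasing events E₁, E₂ (Pp = E₁ ∩ E₂).
    have hH := Literature.Probability.LatticeModels.prodBernoulli_harris_lower w
      (A := Mc₁ ∩ R₁) (B := Mc₁ ∩ R₂)
      ((isLowerSet_notReachable a₁ a₂).inter (isLowerSet_notReachable a₁ a))
      ((isLowerSet_notReachable a₁ a₂).inter (isLowerSet_notReachable a₂ a))
      MeasurableSet.of_discrete MeasurableSet.of_discrete
    have ePP : Mc₁ ∩ R₁ ∩ (Mc₁ ∩ R₂) = Pp := by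
      ext ω; simp only [hPp, mem_inter_iff]; tauto
    simp only [← hμ, ePP, hp0] at hH
    -- hH : μ(E₁) * μ(E₂) ≤ 0
    have hz : μ.real (Mc₁ ∩ R₁) * μ.real (Mc₁ ∩ R₂) = 0 := le_antisymm hH (mul_nonneg hE1 hE2)
    rcases mul_eq_zero.1 hz with h | h
    · have h' : μ.real (Mc₁ ∩ R₁ ∩ O₁) = 0 := measureReal_mono_null inter_subset_left h
      rw [h, h']; nlinarith [hOMR, hE2]
    · have h' : μ.real (Mc₁ ∩ R₂ ∩ O₂) = 0 := measureReal_mono_null inter_subset_left h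
      rw [h, h']; nlinarith [hOMR, hE1]
  · have hPpos : 0 < μ.real Pp := lt_of_le_of_ne hP (Ne.symm hp0)
    -- (a),(b): μ(Eᵢ∩Oᵢ) μ(Pp) ≤ μ(Pp∩Oᵢ) μ(Eᵢ);  (c): (μ(PpO₁)+μ(PpO₂)) μ(MrR) ≤ μ(O∩MrR) μ(Pp)
    have hc : (μ.real (Pp ∩ O₁) + μ.real (Pp ∩ O₂)) * μ.real (Mr ∩ R) ≤
        μ.real ((O₁ ∪ O₂) ∩ (Mr ∩ R)) * μ.real Pp := by nlinarith [hPA]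
    have k1 := mul_le_mul_of_nonneg_right h3a (mul_nonneg hE2 hMR)
    have k2 := mul_le_mul_of_nonneg_right h3b (mul_nonneg hE1 hMR)
    have : μ.real Pp * (μ.real (Mc₁ ∩ R₁ ∩ O₁) * μ.real (Mc₁ ∩ R₂) * μ.real (Mr ∩ R) +
        μ.real (Mc₁ ∩ R₂ ∩ O₂) * μ.real (Mc₁ ∩ R₁) * μ.real (Mr ∩ R)) ≤
        μ.real Pp * (μ.real ((O₁ ∪ O₂) ∩ (Mr ∩ R)) * μ.real (Mc₁ ∩ R₁) * μ.real (Mc₁ ∩ R₂)) := by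
      have hc' := mul_le_mul_of_nonneg_right hc (mul_nonneg hE1 hE2)
      nlinarith [k1, k2, hc', hE1, hE2, hMR, hPO1, hPO2, hP]
    exact le_of_mul_le_mul_left this hPpos

end UnionExchange

end Summit.CriticalPhenomena.PercolationContinuityZ3.Theorems
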